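import Literature.MathematicalPhysics.QuantumFieldTheory.Balaban1983to89.Node00.Record12BgRowCoClassGaugeR
import Literature.MathematicalPhysics.QuantumFieldTheory.Balaban1983to89.Node00.Record12BgRowCoClassCPMFloor

/-!
# NODE 00 — ROW P11's BODY FROM THE FLOOR-CARRYING (8)-SENTENCE: `Record12BgRowCoClassGaugeR` §2 ∕ §3 ∕ §5 (node00-def-K0a's FILE 21 pattern, dag-n21-c's pen (β)) RE-KEYED
# `h15 ↦ h15R : VariationalThm1RegSepTop7MR ∕ …CoP7MR … c …` AT THE FLOOR `c` THOSE LEMMAS ALREADY CARRY FOR THE GAUGE SENTENCE — the K0-body half of the floor-carrying stub-1 chain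

Cell `pub-ymgap` (HUMAN RULINGS D-0062 ∕ D-0088), seat `pub-ymgap-dag-n07-e` g20 (R141 (C) row s3 lineage; DAG node N07 = [B11]; lane owner; declarer of modules 20 ∕ 29 ∕ 46–49), 2026-08-28.
`--kind proof --supports stmt-QuantumFields-20541` (K0⁷; count-neutral).  Item (c3) of LOCATED-STUB1-FLOOR's CONSUMER-SIDE CENSUS (cell bus 2026-08-28 09:47Z): the (8)-sentence
`h15` is APPLIED at exactly one place in the K0 body — `Record12BgRowCoClassGaugeR` §2 `have hplaq := plaqSmallOn_of_thm1RegSepTop7M h15 ν M … hsep hM₁ …` — inside a lemma whose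
signature already binds `(hc : c ≤ ν.M₁)` for the gauge sentence `VariationalThm1GaugeRegSepTop7MR … M c …`.  THIS FILE is that lemma and its two downstream forms with `h15`
floor-carrying (module 49's `VariationalThm1RegSepTop7MR ∕ …CoP7MR`), the one `have` re-sourced to module 49's accessor; signatures otherwise VERBATIM (one hypothesis TYPE changes,
no binder added — `hc` was already there).  THEOREMS ONLY (0 `def`, 0 `sorry`); additive — `Record12BgRowCoClassGaugeR` is NOT edited.

THE PRINT.  [B11] = T. Bałaban, CMP **102** (1985) 277–309 `[Balaban1985Variational]`: Thm 1 (8)–(9) p. 279 for the numerics of the construction (p. 304 lines 1–2 «R₁M₁ sufficiently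
big»); [III] = CMP **119** (1988) `[Balaban1988Convergent]` (2.12)–(2.13) p. 256 (the background field of record), (2.27)–(2.28) p. 259, (2.34)–(2.41) p. 261 (row P11's clauses);
[6] = CMP **99** (1985) `[Balaban1985RegularSpaces]` (1.3)–(1.9) p. 77.

WHAT IS PROVED (sorry-free; no definition; axioms standard).
* §1 ★★★ `bgRowAtDatumU_of_thm1RegSepTop7MR_of_thm1GaugeR` — GaugeR §2's row body for every minimiser, `h15 : VariationalThm1RegSepTop7MR F N Sup c B₃ a₀ a₁`.
* §2 ★★★ `bgRowAtDatumCoP_of_thm1RegSepCoP7MR_of_thm1GaugeR` — GaugeR §3's form at node00-def-R's collar-class minimiser, `h15 : VariationalThm1RegSepCoP7MR F N c B₃ a₀ a₁`.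
* §3 ★ `Stage13Params.bgAtDatumCoP_of_thm1RegSepCoP7MR_of_thm1GaugeR` — GaugeR §5's Stage-13 lift (`hc : c ≤ θ.ν.M₁`), `h15` floor-carrying.
NOT HERE: dag-n21-c's FILE B `provisos₁₃SepCoP_theta13OfThm1CCM_of_thm1GaugeR` re-keyed on §3 (their pen; `hc : c ≤ L^j` is in its signature), the PART 1∕2 closers, the V20 texts (plan).
HONEST SCOPE.  Kernel re-keying BY NAME; nothing of [B11] ∕ [III] asserted; both sentences are HYPOTHESES, inhabited nowhere; `stub_prop8StepCoP13` ∕ K0⁷ NOT closed; N07 NOT discharged;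
counts unmoved (28∕28 · 5∕27); one finite 𝕋⁴ programme at fixed ε — the route closes the conditional finite-𝕋⁴ rung `BalabanLadder.UV` only; nothing continuum ∕ ℝ⁴ ∕ OS ∕ mass gap ∕
Clay.  No `sorry`, no `def`, no `instance`, no `notation`.
-/

noncomputable section

open MeasureTheory
open scoped Matrix.Norms.L2Operator

namespace Literature.MathematicalPhysics.QuantumFieldTheory.Balaban1983to89.Node00

open T4Continuum B14.Eq218Concrete B15DeterminingSets B12RegularSpaces111 B14RegularSpaces234 B14Radii T4AxialGaugeSmallField

/-! ## §1  Row P11's body for every minimiser, from the floor-carrying (8)-sentence and the R gauge sentence -/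

section RowBodyR

variable {F : T4Family} {N : ℕ} [NeZero N]

/-- **★★★ ROW P11's BODY AT `(s, 𝐖)` FOR EVERY MINIMISER `U₀` OVER THE TOP-DOMAIN CLASS (6), FROM THE FLOOR-CARRYING (8)-SENTENCE `VariationalThm1RegSepTop7MR … c …` AND THE R GAUGE SENTENCE** — node00-def-K0a ∕ dag-n21-c's `bgRowAtDatumU_of_thm1RegSepTop7M_of_thm1GaugeR` (`Record12BgRowCoClassGaugeR` §2) with `h15` FLOOR-CARRYING at the SAME floor `c` the gauge sentence carries; the one
application `have hplaq` re-sourced to module 49's `plaqSmallOn_of_thm1RegSepTop7MR … hc …`; every other letter and the proof term byte-identical.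
[cite: Balaban1985Variational, Thm 1 (2),(6)–(9) pp.278–279, p.304 lines 1–2; Balaban1985RegularSpaces, (1.3)–(1.9) p.77; Balaban1988Convergent, (2.4)–(2.8) pp.255–256, (2.12)–(2.13) p.256, (2.27)–(2.28) p.259, (2.34)–(2.41) p.261; Balaban1987RG1, (1.11)–(1.16) p.262] -/
theorem bgRowAtDatumU_of_thm1RegSepTop7MR_of_thm1GaugeR {Sup : (ν : Stage7Numerics) → (K : ℕ) → (ℕ → Set (Site (F.P K) 0)) → Set (Site (F.P K) 0)} {M c : ℕ}
    {B₃ B₃' a₀ a₁ : ℝ} (h15 : VariationalThm1RegSepTop7MR F N Sup c B₃ a₀ a₁) (h15G : VariationalThm1GaugeRegSepTop7MR F N Sup M c B₃ B₃' a₀ a₁)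
    (S : Sect2.Setting (MatA N) (SU N)) (hι : S.ι = ιSU N) (h𝓜 : S.𝓜 = B12RegularSpaces111SpecialUnitary.suModel N) (hS : S.Laws) (hpos : S.Pos)
    (ν : Stage7Numerics) (hM : 0 < M) (K k : ℕ) (cR : ℝ)
    (hnum : ∀ n, n ≤ k → 0 < cR * epsOfRecord ν S.flow.g n ∧ cR * epsOfRecord ν S.flow.g n ≤ a₁ ∧ B₃ * (cR * epsOfRecord ν S.flow.g n) ≤ ν.εreg)
    (ha₀ : ν.εreg ≤ a₀) (hcomp : ∀ n, n < k → cR * epsOfRecord ν S.flow.g n ≤ 2 * (cR * epsOfRecord ν S.flow.g (n + 1)))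
    (hcomp' : ∀ n, n < k → cR * epsOfRecord ν S.flow.g (n + 1) ≤ 2 * (cR * epsOfRecord ν S.flow.g n))
    (hα : ∀ n, 1 ≤ n → n ≤ k → 0 < S.lf.alpha0 (S.flow.g n) ∧ 0 < S.lf.alpha1 (S.flow.g n))
    (hBα : ∀ n, 1 ≤ n → n ≤ k → B₃ * (cR * epsOfRecord ν S.flow.g n) ≤ (1 - S.βc) * S.lf.alpha0 (S.flow.g n))
    (htI : ∀ n, 1 ≤ n → n ≤ k → B₃' * (cR * epsOfRecord ν S.flow.g n) ≤ S.cB * S.lf.alpha0 (S.flow.g n))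
    (htMS : ∀ n, 1 ≤ n → n ≤ k → B₃' * (cR * epsOfRecord ν S.flow.g n) ≤ S.B * S.C * S.Mr * S.lf.alpha0 (S.flow.g n))
    (hC1 : ∀ j, 1 ≤ j → j ≤ k → ∃ t : ℕ, 0 < t ∧ RkOfRecord (F.P K).L ν.r (S.flow.g j) = (F.P K).L * t)
    (hC2 : ∀ j, 1 ≤ j → j ≤ k → dCubeSide (F.P K).L M (RkOfRecord (F.P K).L ν.r (S.flow.g j)) j ∣ (F.P K).sitesPerDir 0)
    (hsN : ∀ n, 1 ≤ n → n ≤ k + 1 → ((B14.Eq213MaximalDomains.side (F.P K).L M n : ℕ) : ℤ) < (F.P K).sitesPerDir 0)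
    (s : SeqOfRecord F ν M S.flow.g K k) (hsep : Sect2.SeqSeparated ν.M₁ s) (hM₁ : 0 < ν.M₁) (hc : c ≤ ν.M₁) {W : MSField (F.P K) (SU N)}
    (h7 : Sect2.DataSmall7PTop (avOfRecord F N K) s.Ω (Sup ν K s.Ω) k (fun n => cR * epsOfRecord ν S.flow.g n) W)
    {U₀ : GaugeField (F.P K) 0 (SU N)} (hmin : IsMinimizer (avOfRecord F N K)
      {U | (∀ n, n ≤ k → PlaqSmallOn (Sect2.omegaPlaqsTop s.Ω (Sup ν K s.Ω) n) (ν.εreg * (F.P K).eta n ^ 2) U) ∧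
        Sect2.CoDivClassOnTop s.Ω (Sup ν K s.Ω) k ν.εreg U} (genSet s.Ω k) W U₀) :
    ∀ j, 1 ≤ j → j ≤ k → ∀ X : (Sect2.domSys (F.P K) M j).Dom,
      (Sect2.domSites (F.P K) M j X ⊆ s.Λ j →
        Sect2.ofBackgroundC S.ι (U₀) ∈
          Sect2.spaceI S (Sect2.Residual.unit (F.P K) (MatA N)) M j (Sect2.domSites (F.P K) M j X) (S.lf.alpha0 (S.flow.g j)) (S.lf.alpha1 (S.flow.g j))) ∧
      (Sect2.admB (F.P K) ν M S.flow.g s.Ω s.Λ j (Sect2.domSites (F.P K) M j X) = true →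
        Sect2.ofBackgroundC S.ι (U₀) ∈
          Sect2.spaceMS S (Sect2.Residual.unit (F.P K) (MatA N)) M j (Sect2.domSites (F.P K) M j X) s.Ω) := by
  have hplaq := plaqSmallOn_of_thm1RegSepTop7MR h15 ν M S.flow.g K k cR s hsep hM₁ hc hnum ha₀ hcomp hcomp' h7 hmin
  have hclass : ∀ n, 1 ≤ n → n ≤ k → PlaqSmallOn (omegaPlaqs s.Ω n) (B₃ * (cR * epsOfRecord ν S.flow.g n) * (F.P K).eta n ^ 2) U₀ := by
    intro n hn1 hnk
    have := hplaq n hnk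
    rwa [Sect2.omegaPlaqsTop_of_ne_zero _ _ (Nat.one_le_iff_ne_zero.mp hn1)] at this
  have hg := localGaugeOn_of_thm1GaugeRegSepTop7MR h15G ν S.flow.g K k cR s hsep hM₁ hc hnum ha₀ hcomp hcomp' h7 hmin
  exact bgRowAtDatumU_of_classBoundsPos_of_localGauge S hι h𝓜 hS hpos ν hM K k s U₀ hclass hα hBα htI htMS hC1 hC2
    (fun n hn1 hnk => (hg n hn1 hnk).1 (hsN n hn1 (by omega))) (fun n hn1 hnk => (hg n hn1 hnk).2 (hsN (n + 1) (by omega) (by omega)))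


end RowBodyR

/-! ## §2  At node00-def-R's collar-class minimiser `UbgMSCoPOfRecord … s 𝐖` -/

section AtRecordR

variable {F : T4Family} {N : ℕ} [NeZero N]

/-- **★★★ ROW P11's BODY AT `(s, 𝐖)` FOR def-R's COLLAR-CLASS MINIMISER `UbgMSCoPOfRecord … s 𝐖`, FROM THE FLOOR-CARRYING (8) `CoP` SENTENCE `VariationalThm1RegSepCoP7MR … c …` AND THE R GAUGE `CoP` SENTENCE, at numerics meeting the floor (`hc : c ≤ ν.M₁`)** — `Record12BgRowCoClassGaugeR` §3's `bgRowAtDatumCoP_of_thm1RegSepCoP7M_of_thm1GaugeR` with `h15` floor-carrying; on the solvable set §1's ★★★, off it the junk `1`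
(`bgRowAtDatum_one`).  The shape dag-n21-c's FILE B closers re-key on under V20 (R-b). [cite: Balaban1985Variational, Thm 1 (2),(6)–(9) pp.278–279, p.304 lines 1–2; Balaban1988Convergent, (2.6)–(2.8) pp.255–256, (2.12)–(2.13) p.256, (2.27)–(2.28) p.259, (2.34)–(2.41) p.261; Balaban1987RG1, (1.11)–(1.16) p.262] -/
theorem bgRowAtDatumCoP_of_thm1RegSepCoP7MR_of_thm1GaugeR {M c : ℕ} {B₃ B₃' a₀ a₁ : ℝ} (h15 : VariationalThm1RegSepCoP7MR F N c B₃ a₀ a₁)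
    (h15G : VariationalThm1GaugeRegSepCoP7MR F N M c B₃ B₃' a₀ a₁)
    (S : Sect2.Setting (MatA N) (SU N)) (hι : S.ι = ιSU N) (h𝓜 : S.𝓜 = B12RegularSpaces111SpecialUnitary.suModel N) (hS : S.Laws) (hpos : S.Pos)
    (ν : Stage7Numerics) (hM : 0 < M) (K k : ℕ) (cR : ℝ)
    (hnum : ∀ n, n ≤ k → 0 < cR * epsOfRecord ν S.flow.g n ∧ cR * epsOfRecord ν S.flow.g n ≤ a₁ ∧ B₃ * (cR * epsOfRecord ν S.flow.g n) ≤ ν.εreg)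
    (ha₀ : ν.εreg ≤ a₀) (hcomp : ∀ n, n < k → cR * epsOfRecord ν S.flow.g n ≤ 2 * (cR * epsOfRecord ν S.flow.g (n + 1)))
    (hcomp' : ∀ n, n < k → cR * epsOfRecord ν S.flow.g (n + 1) ≤ 2 * (cR * epsOfRecord ν S.flow.g n))
    (hα : ∀ n, 1 ≤ n → n ≤ k → 0 < S.lf.alpha0 (S.flow.g n) ∧ 0 < S.lf.alpha1 (S.flow.g n))
    (hBα : ∀ n, 1 ≤ n → n ≤ k → B₃ * (cR * epsOfRecord ν S.flow.g n) ≤ (1 - S.βc) * S.lf.alpha0 (S.flow.g n))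
    (htI : ∀ n, 1 ≤ n → n ≤ k → B₃' * (cR * epsOfRecord ν S.flow.g n) ≤ S.cB * S.lf.alpha0 (S.flow.g n))
    (htMS : ∀ n, 1 ≤ n → n ≤ k → B₃' * (cR * epsOfRecord ν S.flow.g n) ≤ S.B * S.C * S.Mr * S.lf.alpha0 (S.flow.g n))
    (hC1 : ∀ j, 1 ≤ j → j ≤ k → ∃ t : ℕ, 0 < t ∧ RkOfRecord (F.P K).L ν.r (S.flow.g j) = (F.P K).L * t)
    (hC2 : ∀ j, 1 ≤ j → j ≤ k → dCubeSide (F.P K).L M (RkOfRecord (F.P K).L ν.r (S.flow.g j)) j ∣ (F.P K).sitesPerDir 0)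
    (hsN : ∀ n, 1 ≤ n → n ≤ k + 1 → ((B14.Eq213MaximalDomains.side (F.P K).L M n : ℕ) : ℤ) < (F.P K).sitesPerDir 0)
    (s : SeqOfRecord F ν M S.flow.g K k) (hsep : Sect2.SeqSeparated ν.M₁ s) (hM₁ : 0 < ν.M₁) (hc : c ≤ ν.M₁) (W : MSField (F.P K) (SU N))
    (h7 : Sect2.DataSmall7PTop (avOfRecord F N K) s.Ω (suppDomOfRecord F ν K s.Ω) k (fun n => cR * epsOfRecord ν S.flow.g n) W) :
    ∀ j, 1 ≤ j → j ≤ k → ∀ X : (Sect2.domSys (F.P K) M j).Dom,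
      (Sect2.domSites (F.P K) M j X ⊆ s.Λ j →
        Sect2.ofBackgroundC S.ι (UbgMSCoPOfRecord F N ν M S.flow.g K k s W) ∈
          Sect2.spaceI S (Sect2.Residual.unit (F.P K) (MatA N)) M j (Sect2.domSites (F.P K) M j X) (S.lf.alpha0 (S.flow.g j)) (S.lf.alpha1 (S.flow.g j))) ∧
      (Sect2.admB (F.P K) ν M S.flow.g s.Ω s.Λ j (Sect2.domSites (F.P K) M j X) = true →
        Sect2.ofBackgroundC S.ι (UbgMSCoPOfRecord F N ν M S.flow.g K k s W) ∈
          Sect2.spaceMS S (Sect2.Residual.unit (F.P K) (MatA N)) M j (Sect2.domSites (F.P K) M j X) s.Ω) := by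
  by_cases hsol : W ∈ solvableDom (avOfRecord F N K) (regMSCoPOfRecord F N ν K k s.Ω) (genSet s.Ω k)
  · exact bgRowAtDatumU_of_thm1RegSepTop7MR_of_thm1GaugeR h15 h15G S hι h𝓜 hS hpos ν hM K k cR hnum ha₀ hcomp hcomp' hα hBα htI htMS hC1 hC2 hsN s hsep hM₁ hc h7
      (isMinimizer_UbgMSCoPOfRecord ν M S.flow.g K k s hsol)
  · rw [UbgMSCoPOfRecord_eq_one_of_not_mem ν M S.flow.g K k s hsol]
    exact bgRowAtDatum_one S hpos ν M K k s hα


end AtRecordR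

/-! ## §3  The Stage-13 lift with the floor as a witness fact `hc : c ≤ θ.ν.M₁` -/

section LiftR

variable {F : T4Family} {N : ℕ} [NeZero N]

/-- **★ ROW P11's BODY AT `UbgMSCoPOfRecord … n s 𝐖` AT THE STAGE-13 RECORD FROM THE FLOOR-CARRYING (8) `VariationalThm1RegSepCoP7MR … c …` AND THE R GAUGE `CoP` SENTENCE AT CUBE LETTER `θ.τ9.M` AND FLOOR `c`, FOR A PARAMETER MEETING THE FLOOR (`hc : c ≤ θ.ν.M₁`)** — `Record12BgRowCoClassGaugeR` §5's `Stage13Params.bgAtDatumCoP_of_thm1RegSepCoP7M_of_thm1GaugeR` with `h15` floor-carrying at the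
floor the lemma ALREADY carries; every other letter as there (laws∕`Pos`∕radii from admissibility in the window, (C2) = `PartCompat₁₃`).  A REDUCTION — the two sentences are hypotheses, never asserted.
[cite: Balaban1985Variational, (6)–(7) p.278, Thm 1 (8)–(9) p.279, (152) p.301, Prop. 8 p.304, p.304 lines 1–2; Balaban1985RegularSpaces, (1.3)–(1.9) p.77, Prop. 6 p.99; Balaban1988Convergent, Thm 1 p.262, (2.4)–(2.8) pp.255–256, (2.12)–(2.13) p.256, (2.27)–(2.28) p.259] -/
theorem Stage13Params.bgAtDatumCoP_of_thm1RegSepCoP7MR_of_thm1GaugeR (θ : Stage13Params F N) (hθ : θ.Admissible F N) (hRz : θ.Rz = RzOfRecord F N)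
    {c : ℕ} {B₃ B₃' a₀ a₁ : ℝ} (hM : 0 < θ.τ9.M) (hc : c ≤ θ.ν.M₁)
    (h15 : VariationalThm1RegSepCoP7MR F N c B₃ a₀ a₁) (h15G : VariationalThm1GaugeRegSepCoP7MR F N θ.τ9.M c B₃ B₃' a₀ a₁)
    (hnum : ∀ (p : B12.RunParams) (n : ℕ), n ≤ p.K → Step.InInterval θ.γ n (gOfRecord₁₃ F N θ p) → ∀ m, m ≤ n →
      0 < θ.s2.cR * epsOfRecord θ.ν (gOfRecord₁₃ F N θ p) m ∧ θ.s2.cR * epsOfRecord θ.ν (gOfRecord₁₃ F N θ p) m ≤ a₁ ∧ B₃ * (θ.s2.cR * epsOfRecord θ.ν (gOfRecord₁₃ F N θ p) m) ≤ θ.ν.εreg)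
    (ha₀ : θ.ν.εreg ≤ a₀)
    (hcomp : ∀ (p : B12.RunParams) (n : ℕ), n ≤ p.K → Step.InInterval θ.γ n (gOfRecord₁₃ F N θ p) → ∀ m, m < n →
      θ.s2.cR * epsOfRecord θ.ν (gOfRecord₁₃ F N θ p) m ≤ 2 * (θ.s2.cR * epsOfRecord θ.ν (gOfRecord₁₃ F N θ p) (m + 1)))
    (hcomp' : ∀ (p : B12.RunParams) (n : ℕ), n ≤ p.K → Step.InInterval θ.γ n (gOfRecord₁₃ F N θ p) → ∀ m, m < n →
      θ.s2.cR * epsOfRecord θ.ν (gOfRecord₁₃ F N θ p) (m + 1) ≤ 2 * (θ.s2.cR * epsOfRecord θ.ν (gOfRecord₁₃ F N θ p) m))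
    (hBα : ∀ (p : B12.RunParams) (n : ℕ), n ≤ p.K → Step.InInterval θ.γ n (gOfRecord₁₃ F N θ p) → ∀ m, 1 ≤ m → m ≤ n →
      B₃ * (θ.s2.cR * epsOfRecord θ.ν (gOfRecord₁₃ F N θ p) m) ≤ (1 - θ.s2.βc) * (lfOfRecord₁₂ F N θ.toStage12Params).alpha0 (gOfRecord₁₃ F N θ p m))
    (htI : ∀ (p : B12.RunParams) (n : ℕ), n ≤ p.K → Step.InInterval θ.γ n (gOfRecord₁₃ F N θ p) → ∀ m, 1 ≤ m → m ≤ n →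
      B₃' * (θ.s2.cR * epsOfRecord θ.ν (gOfRecord₁₃ F N θ p) m) ≤ θ.s2.cB * (lfOfRecord₁₂ F N θ.toStage12Params).alpha0 (gOfRecord₁₃ F N θ p m))
    (htMS : ∀ (p : B12.RunParams) (n : ℕ), n ≤ p.K → Step.InInterval θ.γ n (gOfRecord₁₃ F N θ p) → ∀ m, 1 ≤ m → m ≤ n →
      B₃' * (θ.s2.cR * epsOfRecord θ.ν (gOfRecord₁₃ F N θ p) m) ≤ θ.s2.B * θ.s2.C * θ.s2.Mr * (lfOfRecord₁₂ F N θ.toStage12Params).alpha0 (gOfRecord₁₃ F N θ p m))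
    (hC1 : ∀ (p : B12.RunParams) (n : ℕ), n ≤ p.K → Step.InInterval θ.γ n (gOfRecord₁₃ F N θ p) → ∀ j, 1 ≤ j → j ≤ n →
      ∃ t : ℕ, 0 < t ∧ RkOfRecord (F.P p.K).L θ.ν.r (gOfRecord₁₃ F N θ p j) = (F.P p.K).L * t)
    (hsN : ∀ (p : B12.RunParams) (n : ℕ), n ≤ p.K → ∀ n', 1 ≤ n' → n' ≤ n + 1 →
      ((B14.Eq213MaximalDomains.side (F.P p.K).L θ.τ9.M n' : ℕ) : ℤ) < (F.P p.K).sitesPerDir 0) :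
    ∀ (p : B12.RunParams) (n : ℕ), n ≤ p.K → Step.InInterval θ.γ n (gOfRecord₁₃ F N θ p) → PartCompat₁₃ F N θ p n →
      ∀ s : SeqOfRecord F θ.ν θ.τ9.M (gOfRecord₁₃ F N θ p) p.K n, Sect2.SeqSeparated θ.ν.M₁ s → 0 < θ.ν.M₁ → ∀ W : MSField (F.P p.K) (SU N),
      Sect2.DataSmall7PTop (avOfRecord F N p.K) s.Ω (suppDomOfRecord F θ.ν p.K s.Ω) n (fun j => θ.s2.cR * epsOfRecord θ.ν (gOfRecord₁₃ F N θ p) j) W →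
      ∀ j, 1 ≤ j → j ≤ n → ∀ X : (Sect2.domSys (F.P p.K) θ.τ9.M j).Dom,
      (Sect2.domSites (F.P p.K) θ.τ9.M j X ⊆ s.Λ j →
        Sect2.ofBackgroundC (settingOfRecord₁₃ F N θ p).ι (UbgMSCoPOfRecord F N θ.ν θ.τ9.M (gOfRecord₁₃ F N θ p) p.K n s W) ∈
          Sect2.spaceI (settingOfRecord₁₃ F N θ p) (θ.Rz p.K) θ.τ9.M j (Sect2.domSites (F.P p.K) θ.τ9.M j X)
            ((settingOfRecord₁₃ F N θ p).lf.alpha0 ((settingOfRecord₁₃ F N θ p).flow.g j)) ((settingOfRecord₁₃ F N θ p).lf.alpha1 ((settingOfRecord₁₃ F N θ p).flow.g j))) ∧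
      (Sect2.admB (F.P p.K) θ.ν θ.τ9.M (gOfRecord₁₃ F N θ p) s.Ω s.Λ j (Sect2.domSites (F.P p.K) θ.τ9.M j X) = true →
        Sect2.ofBackgroundC (settingOfRecord₁₃ F N θ p).ι (UbgMSCoPOfRecord F N θ.ν θ.τ9.M (gOfRecord₁₃ F N θ p) p.K n s W) ∈
          Sect2.spaceMS (settingOfRecord₁₃ F N θ p) (θ.Rz p.K) θ.τ9.M j (Sect2.domSites (F.P p.K) θ.τ9.M j X) s.Ω) := by
  intro p n hn hw hpc s hsep hM₁ W h7
  rw [hRz]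
  exact bgRowAtDatumCoP_of_thm1RegSepCoP7MR_of_thm1GaugeR h15 h15G (settingOfRecord₁₃ F N θ p) rfl rfl (settingOfRecord₁₃_laws F N θ p)
    (settingOfRecord₁₃_pos F N θ hθ.1.pos p) θ.ν hM p.K n θ.s2.cR (hnum p n hn hw) ha₀ (hcomp p n hn hw) (hcomp' p n hn hw)
    (fun m _ hm => alphaPos₁₃_of_inInterval hθ hw hm) (hBα p n hn hw) (htI p n hn hw) (htMS p n hn hw) (hC1 p n hn hw) hpc (hsN p n hn) s hsep hM₁ hc W h7


end LiftR

end Literature.MathematicalPhysics.QuantumFieldTheory.Balaban1983to89.Node00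

end
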